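import Literature.IUT.HodgeTheaters.InitialThetaDataLocalGalois
import Literature.IUT.HodgeTheaters.InitialThetaDataLocalGroups
import Literature.IUT.HodgeTheaters.GoodLocalFrobenioidOfGalois
import HarnessLib

/-!
# [IUTchI] Example 3.3 (i)–(ii) AT THE DATUM: `D_v̲ = 𝓑(Π_v̲)⁰ ⊇ D⊢_v̲ = 𝓑(K_v̲)⁰` for `Π_v̲ := Π_{X̲→_v̲}` of
# Definition 3.1 (f)

S. Mochizuki, *Inter-universal Teichmüller theory I*, §3, Example 3.3 (i)–(ii) (kurims final manuscript, May
2020, pp. 77–79) with Definition 3.1 (e), (f) (pp. 62–63) [claim: Mochizuki2012, status: disputed]. Print, Ex. 3.3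
(i) pp. 77–78: "Let `v̲ ∈ V̲^good ∩ V̲^non`. … the `p_v`-adic Frobenioid `C_v` … whose base category is … `D_v :=
𝓑(X̲→_v̲)⁰` … `D⊢_v := 𝓑(K_v̲)⁰` … may be naturally regarded [by pulling back finite étale coverings via the
structure morphism `X̲→_v̲ → Spec(K_v̲)`] as a full subcategory `D⊢_v ⊆ D_v` … we also have a natural functor
`D_v → D⊢_v`, which is left-adjoint to the natural inclusion functor."

This file ASSEMBLES, for `D : InitialThetaData F K Fbar E l P` (the REAL Def. 3.1 of abc-iut-L5-t2) and a complete
nonarchimedean field `k = K_v̲` finite over `ℚ_p` containing `K`, an inhabitant of abc-iut-L5-t2's frozen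
interface `GoodLocalFrobenioid p k` (`SplitFrobenioids.lean`, Ex. 3.3 (i)–(iii)) in which
* `D_v̲ := 𝓑(Π_v̲)⁰ = CosetCat Π_v̲` for **`Π_v̲ := Π_{X̲→_v̲} = Π_{X̲→_K} ×_{G_K} Gal(k̄/k)`** of Def. 3.1 (f)
  (`InitialThetaData.PiLoc` of `InitialThetaDataLocalGroups.lean`, along `localToGF F k ι : Gal(k̄/k) → G_F` of
  `InitialThetaDataLocalGalois.lean`, whose image is the decomposition group `G_v̲ ⊆ G_K`), `D⊢_v̲ := 𝓑(K_v̲)⁰ =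
  CosetCat Gal(k̄/k)` pulled back along the natural surjection `Π_v̲ ↠ Gal(k̄/k)` (continuous; SURJECTIVE by
  `galoisSubgroupOf_le_map_PiXarrow` + `decompositionSubgroupGF_le`; OPEN given the printed clause Def. 3.1 (f)
  "open subgroups `Π_{X̲→_K} ⊆ … ⊆ Π_{C_F}`", the hypothesis `hX`), `D_v̲ → D⊢_v̲` its left adjoint
  (`CosetCat.pushPullAdj`);
* the field functor `Spec L ↦ L` on `k̄` with the spectral norm (`GaloisValDatum.ofComplete`) and the Frobenioid
  side `Φ_{C_v} = ord(𝒪^▷)^pf ⊇ Φ_{C⊢_v} = ℕ·ord(p_v)` of abc-iut-L1-t4's [FrdII] Ex. 1.1 kit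
  (`GoodLocalFrobenioid.ofGalois` / `ofKit`, gen-3 files of this seat).
Every input now comes from `D` except `hX`: `goodLocalFrobenioidOfEmb` (given embedding `ι : F̄ → k̄`),
`goodLocalFrobenioid` (chosen `ι`, `localEmb`), `goodLocalFrobenioidAt` (the completion `k := K_w` at a finite place
`w ∣ p`, abc-iut-S7's `RescaledCompletion K p w hw`). Nothing of the series is asserted; no side is taken.
-/

noncomputable section

namespace Literature.IUT.HodgeTheaters

universe u v

/-! ### Example 3.3 (i)–(ii) AT THE DATUM, `K_v̲ = k` a complete field finite over `ℚ_p` -/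

section Example33

open Literature.AnabelianGeometry.SemiGraphs

variable {F : Type u} {K : Type v} {Fbar : Type} [Field F] [NumberField F] [Field K] [NumberField K]
  [Algebra F K] [Field Fbar] [Algebra F Fbar] [Algebra K Fbar] [IsScalarTower F K Fbar] [Normal K Fbar]
  {E : WeierstrassCurve F} [E.IsElliptic] {l : ℕ} {Pb : BadPlacePredicates K}
  (D : InitialThetaData F K Fbar E l Pb) (p : ℕ) [Fact p.Prime]
  (k : Type) [NontriviallyNormedField k] [CompleteSpace k] [IsUltrametricDist k] [NormedAlgebra ℚ_[p] k]
  [FiniteDimensional ℚ_[p] k] [Algebra K k]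

namespace InitialThetaData

omit [CompleteSpace k] [IsUltrametricDist k] in
/-- `Π_v̲ ↠ Gal(k̄/k)` is surjective: its image `G_v̲ ⊆ G_K` (`decompositionSubgroupGF_le`) is covered by
`Π_{X̲→_K} ↠ G_K` (`galoisSubgroupOf_le_map_PiXarrow`). [claim: Mochizuki2012, status: disputed] -/
theorem augLoc_PiXarrow_surjective (ι : Fbar →ₐ[K] AlgebraicClosure k) :
    Function.Surjective (D.augLoc D.PiXarrow (localToGF F k ι)) :=
  D.augLoc_surjective D.PiXarrow (localToGF F k ι)
    ((decompositionSubgroupGF_le F k ι).trans D.galoisSubgroupOf_le_map_PiXarrow)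

/-- **[IUTchI] Example 3.3 (i)–(ii) for the initial Θ-datum `D` at `v̲ ∈ V̲^good ∩ V̲^non`**, `K_v̲ = k` a
complete nonarchimedean field finite over `ℚ_p` containing `K`, along a `K`-embedding `ι : F̄ → k̄`: the
inhabitant of `GoodLocalFrobenioid p k` with `D_v̲ := 𝓑(Π_v̲)⁰ = CosetCat Π_v̲` for **`Π_v̲ := Π_{X̲→_v̲}` of
Def. 3.1 (f)** (`PiLoc D.PiXarrow (localToGF F k ι)`), `D⊢_v̲ := 𝓑(K_v̲)⁰ = CosetCat Gal(k̄/k)` pulled back along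
`Π_v̲ ↠ Gal(k̄/k)` (`augLoc`: continuous, surjective, open), field functor `Spec L ↦ L` (`k̄` with the spectral
norm, `GaloisValDatum.ofComplete`) and abc-iut-L1-t4's [FrdII] Ex. 1.1 Frobenioids (`GoodLocalFrobenioid.ofGalois`).
Inputs: `D`, `ι`, and the printed openness `hX` of `Π_{X̲→_K}` (Def. 3.1 (f)).
[claim: Mochizuki2012, status: disputed] -/
def goodLocalFrobenioidOfEmb (ι : Fbar →ₐ[K] AlgebraicClosure k) (hX : IsOpen (D.PiXarrow : Set D.PiC)) :
    @GoodLocalFrobenioid.{0} p k _ (GaloisValDatum.normVal k) :=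
  @GoodLocalFrobenioid.ofGalois p _ (GaloisValDatum.ofComplete p k) _ _ _ (D.augLoc D.PiXarrow (localToGF F k ι))
    (D.continuous_augLoc D.PiXarrow (localToGF F k ι)) (D.augLoc_PiXarrow_surjective k ι)
    (D.isOpenMap_augLoc D.PiXarrow (localToGF F k ι) hX (continuous_localToGF F k ι)) k _
    (GaloisValDatum.normVal k) (GaloisValDatum.p_mem_normVal p k)

/-- `D_v̲` of `goodLocalFrobenioidOfEmb` IS `CosetCat Π_v̲` and `D⊢_v̲` IS `CosetCat Gal(k̄/k)`.
[claim: Mochizuki2012, status: disputed] -/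
theorem goodLocalFrobenioidOfEmb_bases (ι : Fbar →ₐ[K] AlgebraicClosure k)
    (hX : IsOpen (D.PiXarrow : Set D.PiC)) :
    @GoodLocalFrobenioid.Dv p k _ (GaloisValDatum.normVal k) (D.goodLocalFrobenioidOfEmb p k ι hX) =
        CosetCat (D.PiLoc D.PiXarrow (localToGF F k ι)) ∧
      @GoodLocalFrobenioid.Ddash p k _ (GaloisValDatum.normVal k) (D.goodLocalFrobenioidOfEmb p k ι hX) =
        CosetCat (AlgebraicClosure k ≃ₐ[k] AlgebraicClosure k) :=
  ⟨rfl, rfl⟩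

/-- `D⊢_v̲ ⊆ D_v̲` of `goodLocalFrobenioidOfEmb` IS the pull-back along `Π_v̲ ↠ Gal(k̄/k)` ("by pulling back
finite étale coverings via the structure morphism") and `D_v̲ → D⊢_v̲` the push-forward ("left-adjoint to the
natural inclusion functor"). [claim: Mochizuki2012, status: disputed] -/
theorem goodLocalFrobenioidOfEmb_incl_proj (ι : Fbar →ₐ[K] AlgebraicClosure k)
    (hX : IsOpen (D.PiXarrow : Set D.PiC)) :
    @GoodLocalFrobenioid.incl p k _ (GaloisValDatum.normVal k) (D.goodLocalFrobenioidOfEmb p k ι hX) =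
        CosetCat.pull (D.augLoc D.PiXarrow (localToGF F k ι))
          (D.continuous_augLoc D.PiXarrow (localToGF F k ι)) (D.augLoc_PiXarrow_surjective k ι) ∧
      @GoodLocalFrobenioid.proj p k _ (GaloisValDatum.normVal k) (D.goodLocalFrobenioidOfEmb p k ι hX) =
        CosetCat.push (D.augLoc D.PiXarrow (localToGF F k ι))
          (D.isOpenMap_augLoc D.PiXarrow (localToGF F k ι) hX (continuous_localToGF F k ι)) :=
  ⟨rfl, rfl⟩

/-- **[IUTchI] Example 3.3 (i)–(ii) for `D` at `v̲ ∈ V̲^good ∩ V̲^non` with `K_v̲ = k`**, for the chosen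
embedding `F̄ → k̄` (`localEmb`; another choice conjugates `G_v̲`, `decompositionSubgroup_conj`).
[claim: Mochizuki2012, status: disputed] -/
def goodLocalFrobenioid (hX : IsOpen (D.PiXarrow : Set D.PiC)) :
    @GoodLocalFrobenioid.{0} p k _ (GaloisValDatum.normVal k) :=
  D.goodLocalFrobenioidOfEmb p k (localEmb (AlgebraicClosure k)) hX

end InitialThetaData

end Example33

/-! ### At an actual place `v̲ = w ∣ p` of `K`: `K_v̲ := RescaledCompletion K p w` -/

section Place

open Literature.NumberTheory.NumberFields IsDedekindDomain NumberField

variable {F : Type u} {K : Type} {Fbar : Type} [Field F] [NumberField F] [Field K] [NumberField K]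
  [Algebra F K] [Field Fbar] [Algebra F Fbar] [Algebra K Fbar] [IsScalarTower F K Fbar] [Normal K Fbar]
  {E : WeierstrassCurve F} [E.IsElliptic] {l : ℕ} {Pb : BadPlacePredicates K}
  (D : InitialThetaData F K Fbar E l Pb) (w : HeightOneSpectrum (𝓞 K)) (p : ℕ) [Fact p.Prime]
  (hw : ((p : ℕ) : 𝓞 K) ∈ w.asIdeal)

namespace InitialThetaData

/-- **[IUTchI] Example 3.3 (i)–(ii) for `D` at the finite place `v̲ = w ∣ p` of `K`** (`v̲ ∈ V̲^good ∩ V̲^non`):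
`K_v̲ := K_w`, the completion (abc-iut-S7's `RescaledCompletion K p w hw`, normed by `‖·‖_w^{1/n_w}`, a
`K`-algebra through `K ↪ K_w`), `Ω := K̄_w` with the spectral norm, `Π_v̲ := Π_{X̲→_K} ×_{G_K} Gal(K̄_w/K_w)`
for the chosen embedding `F̄ → K̄_w`. Inputs: `D` and the printed openness `hX` of `Π_{X̲→_K}`.
[claim: Mochizuki2012, status: disputed] -/
def goodLocalFrobenioidAt (hX : IsOpen (D.PiXarrow : Set D.PiC)) :
    @GoodLocalFrobenioid.{0} p (RescaledCompletion K p w hw) _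
      (GaloisValDatum.normVal (RescaledCompletion K p w hw)) :=
  letI : Algebra K (RescaledCompletion K p w hw) := inferInstanceAs (Algebra K (w.adicCompletion K))
  haveI := GaloisValDatum.finiteDimensional_rescaledCompletion K p w hw
  D.goodLocalFrobenioid p (RescaledCompletion K p w hw) hX

end InitialThetaData

end Place

end Literature.IUT.HodgeTheaters

end
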